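import Summits.Parity.GeneralizedHardyLittlewood.Theorems.BeyondDiagonalBeatsQuarter.OffDiagPoissonTwistedSmooth
import Mathlib.Analysis.Normed.Ring.InfiniteSum
import Mathlib.Analysis.PSeries
import HarnessLib

/-!
# Route `PrimeLevelFamEdge`, crux K_B (stmt-Parity-20343), line `diagonal_kernel_split`, plan Ω,
# sub-line **d1** (part 3) — absolute convergence of the dual lattice sum; the lattice form for smooth weights

Parts 1–2 (`OffDiagPoissonTwisted`, `OffDiagPoissonTwistedSmooth`) give the twisted Poisson formula with the
dual sum ITERATED (`Σ_{k₂} Σ_{k₁}`), and over the lattice `ℤ × ℤ` conditionally on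
`Σ_{(k₁,k₂)} |Φ̂(k₁/c,k₂/c)| < ∞`. Here that condition is discharged:

* `norm_fourier2_lattice_le` — for `Φ` with the second partial derivatives `Θ₁ = ∂₁²Φ`, `Θ₂ = ∂₂²Φ`,
  `Θ₂₁ = ∂₁²∂₂²Φ` given explicitly (the hypotheses of the tree's `norm_fourier2_le_left/right/mixed`):
  `|Φ̂(k₁/c, k₂/c)| ≤ (I₀ + I₁ + I₂ + I₃) · b_c(k₁) · b_c(k₂)`, `b_c(0) = 1`, `b_c(j) = (c/(2π|j|))²` (`j ≠ 0`),
  `I₀ = ∫∫|Φ|`, `I₁ = ∫∫|Θ₁|`, `I₂ = ∫∫|Θ₂|`, `I₃ = ∫∫|Θ₂₁|` — explicit in `c` for the quantitative steps Ω-e/f;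
  `summable_latticeWeight` (`Σ_j b_c(j) < ∞`), `summable_fourier2_lattice`;
* for `uncurry Φ` smooth of compact support the `Θ`'s are built from `D²F`, `D⁴F` (`F = uncurry Φ`) by the
  slice formulas of part 2 (`summable_fourier2_lattice_of_contDiff`), whence the **lattice form**
  `tsum_prod_mul_stdAddChar_eq_of_contDiff`:
  `Σ_{(n₁,n₂) ∈ ℤ²} Φ(n₁,n₂) K(n₁,n₂) = c⁻² Σ_{(k₁,k₂) ∈ ℤ²} Φ̂(k₁/c,k₂/c) · Σ_{x₁,x₂ : ZMod c} K(x₁,x₂) e_c(k₁x₁ + k₂x₂)`,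
  both sides absolutely convergent, and the same with the left side over `ℕ × ℕ` when `Φ` lives on the open
  quadrant (`tsum_nat_prod_mul_stdAddChar_eq_of_contDiff`) — the shape of `PeterssonSplit.offDiag`'s layers.

Folklore analysis, PROVED; theorems only; no bound on any off-diagonal term. Helper; closes nothing.
«The programme SEARCHES and TYPES; no claim about Landau–Siegel zeros, Theorems 1–2 of arXiv:2211.02515
or a repaired Margin232 until a kernel theorem says so.»
-/

noncomputable section

open Real MeasureTheory Filter Complex Finset Set
open scoped FourierTransform Topology ContDiff

namespace Summit.Parity.GeneralizedHardyLittlewood.Theorems.BeyondDiagonalBeatsQuarter.OffDiagPoissonTwisted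

open Literature.NumberTheory.Sieve.FriedlanderIwaniecPrimes

/-! ### The lattice majorant `b_c` -/

/-- The lattice majorant: `b_c(0) = 1`, `b_c(j) = (c/(2π|j|))²` for `j ≠ 0`. Written inline below as
`if j = 0 then 1 else (c / (2π|j|))²`; this lemma records its non-negativity. [folklore] -/
theorem latticeWeight_nonneg (c : ℝ) (j : ℤ) :
    0 ≤ (if j = 0 then (1 : ℝ) else (c / (2 * π * |(j : ℝ)|)) ^ 2) := by
  split_ifs
  · exact zero_le_one
  · positivity

/-- `Σ_{j ∈ ℤ} b_c(j) < ∞` (comparison with `Σ 1/j²`). [folklore] -/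
theorem summable_latticeWeight (c : ℝ) :
    Summable fun j : ℤ => (if j = 0 then (1 : ℝ) else (c / (2 * π * |(j : ℝ)|)) ^ 2) := by
  have h2 : Summable fun j : ℤ => (c / (2 * π)) ^ 2 * (1 / (j : ℝ) ^ 2) :=
    (Real.summable_one_div_int_pow.mpr one_lt_two).mul_left _
  have h1 : Summable fun j : ℤ => (if j = 0 then (1 : ℝ) else 0) :=
    summable_of_ne_finset_zero (s := {0}) (by intro j hj; simp [Finset.mem_singleton] at hj; simp [hj])
  refine (h1.add h2).congr fun j => ?_
  by_cases hj : j = 0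
  · simp [hj]
  · have hj' : (j : ℝ) ≠ 0 := by exact_mod_cast hj
    have hπ : (π : ℝ) ≠ 0 := Real.pi_ne_zero
    rw [if_neg hj, if_neg hj, zero_add, div_pow, div_pow, mul_pow, mul_pow, sq_abs]
    field_simp

/-! ### The lattice bound for `Φ̂` from the four partial-integration bounds -/

section LatticeBound

variable {Φ : ℝ → ℝ → ℂ} {R : ℝ}

/-- **Lattice bound.** With `Θ₁ = ∂₁²Φ`, `Θ₂ = ∂₂²Φ`, `Θ₂₁ = ∂₁²∂₂²Φ` jointly continuous of box support
(hypotheses as in `norm_fourier2_le_left/right/mixed`) and `c > 0`: for all `k₁, k₂ ∈ ℤ`,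
`|Φ̂(k₁/c,k₂/c)| ≤ (∫∫|Φ| + ∫∫|Θ₁| + ∫∫|Θ₂| + ∫∫|Θ₂₁|) · b_c(k₁) · b_c(k₂)`. [folklore] -/
theorem norm_fourier2_lattice_le (h : BoxSupport Φ R) (hc : Continuous (Function.uncurry Φ))
    (hs₁ : ∀ t₂, ContDiff ℝ ∞ (fun t₁ => Φ t₁ t₂)) (hs₂ : ∀ t₁, ContDiff ℝ ∞ (Φ t₁))
    {Θ₁ : ℝ → ℝ → ℂ} (hΘ₁ : ∀ t₂, iteratedDeriv 2 (fun t₁ => Φ t₁ t₂) = fun t₁ => Θ₁ t₁ t₂)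
    (hΘ₁s : BoxSupport Θ₁ R) (hΘ₁c : Continuous (Function.uncurry Θ₁))
    {Θ₂ : ℝ → ℝ → ℂ} (hΘ₂ : ∀ t₁, iteratedDeriv 2 (Φ t₁) = Θ₂ t₁) (hΘ₂s : BoxSupport Θ₂ R)
    (hΘ₂c : Continuous (Function.uncurry Θ₂)) (hΘ₂d : ∀ t₂, ContDiff ℝ ∞ (fun t₁ => Θ₂ t₁ t₂))
    {Θ₂₁ : ℝ → ℝ → ℂ} (hΘ₂₁ : ∀ t₂, iteratedDeriv 2 (fun t₁ => Θ₂ t₁ t₂) = fun t₁ => Θ₂₁ t₁ t₂)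
    (hΘ₂₁s : BoxSupport Θ₂₁ R) (hΘ₂₁c : Continuous (Function.uncurry Θ₂₁))
    {c : ℝ} (hc0 : 0 < c) (k₁ k₂ : ℤ) :
    ‖fourier2 Φ (k₁ / c) (k₂ / c)‖ ≤
      ((∫ t₁, ∫ t₂, ‖Φ t₁ t₂‖) + (∫ t₂, ∫ t₁, ‖Θ₁ t₁ t₂‖) + (∫ t₁, ∫ t₂, ‖Θ₂ t₁ t₂‖) +
          ∫ t₂, ∫ t₁, ‖Θ₂₁ t₁ t₂‖) *
        (if k₁ = 0 then (1 : ℝ) else (c / (2 * π * |(k₁ : ℝ)|)) ^ 2) *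
        (if k₂ = 0 then (1 : ℝ) else (c / (2 * π * |(k₂ : ℝ)|)) ^ 2) := by
  set I₀ : ℝ := ∫ t₁, ∫ t₂, ‖Φ t₁ t₂‖ with hI₀
  set I₁ : ℝ := ∫ t₂, ∫ t₁, ‖Θ₁ t₁ t₂‖ with hI₁
  set I₂ : ℝ := ∫ t₁, ∫ t₂, ‖Θ₂ t₁ t₂‖ with hI₂
  set I₃ : ℝ := ∫ t₂, ∫ t₁, ‖Θ₂₁ t₁ t₂‖ with hI₃
  have hI₀0 : 0 ≤ I₀ := integral_nonneg fun _ => integral_nonneg fun _ => norm_nonneg _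
  have hI₁0 : 0 ≤ I₁ := integral_nonneg fun _ => integral_nonneg fun _ => norm_nonneg _
  have hI₂0 : 0 ≤ I₂ := integral_nonneg fun _ => integral_nonneg fun _ => norm_nonneg _
  have hI₃0 : 0 ≤ I₃ := integral_nonneg fun _ => integral_nonneg fun _ => norm_nonneg _
  -- the weight at a non-zero frequency is the partial-integration factor
  have hw : ∀ k : ℤ, k ≠ 0 →
      ((2 * π * |(k : ℝ) / c|) ^ 2)⁻¹ = (c / (2 * π * |(k : ℝ)|)) ^ 2 := by
    intro k hk
    have hk' : (k : ℝ) ≠ 0 := by exact_mod_cast hk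
    rw [abs_div, abs_of_pos hc0, ← inv_pow, inv_eq_one_div]
    congr 1
    field_simp
  have hne : ∀ k : ℤ, k ≠ 0 → (k : ℝ) / c ≠ 0 := fun k hk =>
    div_ne_zero (by exact_mod_cast hk) hc0.ne'
  by_cases hk₁ : k₁ = 0 <;> by_cases hk₂ : k₂ = 0
  · -- trivial bound
    rw [if_pos hk₁, if_pos hk₂, mul_one, mul_one]
    refine (norm_fourier2_le h hc _ _).trans ?_
    linarith
  · -- two partial integrations in `t₂`
    rw [if_pos hk₁, if_neg hk₂, mul_one, ← hw k₂ hk₂]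
    refine (norm_fourier2_le_right h hs₂ hΘ₂ hΘ₂s hΘ₂c _ (hne k₂ hk₂)).trans ?_
    rw [mul_comm]
    exact mul_le_mul_of_nonneg_right (by linarith) (by positivity)
  · -- two partial integrations in `t₁`
    rw [if_neg hk₁, if_pos hk₂, mul_one, ← hw k₁ hk₁]
    refine (norm_fourier2_le_left h hc hs₁ hΘ₁ hΘ₁s hΘ₁c (hne k₁ hk₁) _).trans ?_
    rw [mul_comm]
    exact mul_le_mul_of_nonneg_right (by linarith) (by positivity)
  · -- two partial integrations in each variable
    rw [if_neg hk₁, if_neg hk₂, ← hw k₁ hk₁, ← hw k₂ hk₂]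
    refine (norm_fourier2_le_mixed h hs₂ hΘ₂ hΘ₂s hΘ₂c hΘ₂d hΘ₂₁ hΘ₂₁s hΘ₂₁c
      (hne k₁ hk₁) (hne k₂ hk₂)).trans ?_
    rw [show ((2 * π * |(k₁ : ℝ) / c|) ^ 2)⁻¹ * ((2 * π * |(k₂ : ℝ) / c|) ^ 2)⁻¹ * I₃ =
      I₃ * ((2 * π * |(k₁ : ℝ) / c|) ^ 2)⁻¹ * ((2 * π * |(k₂ : ℝ) / c|) ^ 2)⁻¹ by ring]
    exact mul_le_mul_of_nonneg_right (mul_le_mul_of_nonneg_right (by linarith) (by positivity))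
      (by positivity)

/-- **Absolute convergence of the dual lattice sum** under the hypotheses of `norm_fourier2_lattice_le`:
`Σ_{(k₁,k₂) ∈ ℤ²} |Φ̂(k₁/c,k₂/c)| < ∞`. [folklore] -/
theorem summable_fourier2_lattice (h : BoxSupport Φ R) (hc : Continuous (Function.uncurry Φ))
    (hs₁ : ∀ t₂, ContDiff ℝ ∞ (fun t₁ => Φ t₁ t₂)) (hs₂ : ∀ t₁, ContDiff ℝ ∞ (Φ t₁))
    {Θ₁ : ℝ → ℝ → ℂ} (hΘ₁ : ∀ t₂, iteratedDeriv 2 (fun t₁ => Φ t₁ t₂) = fun t₁ => Θ₁ t₁ t₂)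
    (hΘ₁s : BoxSupport Θ₁ R) (hΘ₁c : Continuous (Function.uncurry Θ₁))
    {Θ₂ : ℝ → ℝ → ℂ} (hΘ₂ : ∀ t₁, iteratedDeriv 2 (Φ t₁) = Θ₂ t₁) (hΘ₂s : BoxSupport Θ₂ R)
    (hΘ₂c : Continuous (Function.uncurry Θ₂)) (hΘ₂d : ∀ t₂, ContDiff ℝ ∞ (fun t₁ => Θ₂ t₁ t₂))
    {Θ₂₁ : ℝ → ℝ → ℂ} (hΘ₂₁ : ∀ t₂, iteratedDeriv 2 (fun t₁ => Θ₂ t₁ t₂) = fun t₁ => Θ₂₁ t₁ t₂)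
    (hΘ₂₁s : BoxSupport Θ₂₁ R) (hΘ₂₁c : Continuous (Function.uncurry Θ₂₁))
    {c : ℝ} (hc0 : 0 < c) :
    Summable fun k : ℤ × ℤ => fourier2 Φ (k.1 / c) (k.2 / c) := by
  set I : ℝ := (∫ t₁, ∫ t₂, ‖Φ t₁ t₂‖) + (∫ t₂, ∫ t₁, ‖Θ₁ t₁ t₂‖) + (∫ t₁, ∫ t₂, ‖Θ₂ t₁ t₂‖) +
    ∫ t₂, ∫ t₁, ‖Θ₂₁ t₁ t₂‖ with hI
  set b : ℤ → ℝ := fun j => if j = 0 then (1 : ℝ) else (c / (2 * π * |(j : ℝ)|)) ^ 2 with hb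
  have hbs : Summable fun j : ℤ => ‖b j‖ := by
    refine (summable_latticeWeight c).congr fun j => ?_
    rw [hb, Real.norm_of_nonneg (latticeWeight_nonneg c j)]
  have hprod : Summable fun k : ℤ × ℤ => I * (b k.1 * b k.2) :=
    (summable_mul_of_summable_norm hbs hbs).mul_left I
  refine Summable.of_norm_bounded hprod fun k => ?_
  rw [← mul_assoc]
  exact norm_fourier2_lattice_le h hc hs₁ hs₂ hΘ₁ hΘ₁s hΘ₁c hΘ₂ hΘ₂s hΘ₂c hΘ₂d hΘ₂₁ hΘ₂₁s hΘ₂₁c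
    hc0 k.1 k.2

end LatticeBound

/-! ### Smooth compactly supported weights: the `Θ`'s from `D²F`, `D⁴F` -/

section Smooth

variable {Φ : ℝ → ℝ → ℂ}

/-- `p ↦ DⁿF(p)(v,…,v)` is smooth for smooth `F`. [folklore] -/
theorem contDiff_iteratedFDeriv_apply_const {F : ℝ × ℝ → ℂ} (hF : ContDiff ℝ ∞ F) (n : ℕ)
    (v : ℝ × ℝ) : ContDiff ℝ ∞ (fun p => iteratedFDeriv ℝ n F p (fun _ => v)) :=
  (ContinuousMultilinearMap.apply ℝ (fun _ : Fin n => ℝ × ℝ) ℂ (fun _ => v)).contDiff.comp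
    (hF.iteratedFDeriv_right (le_of_eq (by norm_cast)))

/-- `tsupport (p ↦ DⁿF(p)(v,…,v)) ⊆ tsupport F`. [folklore] -/
theorem tsupport_iteratedFDeriv_apply_const_subset (F : ℝ × ℝ → ℂ) (n : ℕ) (v : ℝ × ℝ) :
    tsupport (fun p => iteratedFDeriv ℝ n F p (fun _ => v)) ⊆ tsupport F := by
  refine closure_minimal (fun p hp => ?_) (isClosed_tsupport F)
  refine support_iteratedFDeriv_subset (𝕜 := ℝ) n (Function.mem_support.mpr fun h0 => ?_)
  exact hp (by simp [h0])

/-- The second slice derivative `Θ₂(t₁,t₂) := ∂₂²Φ(t₁,t₂)` of a smooth `Φ` is `p ↦ D²F(p)(e₂,e₂)`. [folklore] -/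
theorem uncurry_iteratedDeriv_slice_right (hΦ : ContDiff ℝ ∞ (Function.uncurry Φ)) (n : ℕ) :
    (Function.uncurry fun t₁ t₂ => iteratedDeriv n (Φ t₁) t₂) =
      fun p => iteratedFDeriv ℝ n (Function.uncurry Φ) p (fun _ => ((0 : ℝ), (1 : ℝ))) := by
  funext p
  exact iteratedDeriv_slice_right hΦ n p.1 p.2

/-- The slice derivative `Θ₁(t₁,t₂) := ∂₁ⁿΦ(t₁,t₂)` of a smooth `Φ` is `p ↦ DⁿF(p)(e₁,…,e₁)`. [folklore] -/
theorem uncurry_iteratedDeriv_slice_left (hΦ : ContDiff ℝ ∞ (Function.uncurry Φ)) (n : ℕ) :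
    (Function.uncurry fun t₁ t₂ => iteratedDeriv n (fun s => Φ s t₂) t₁) =
      fun p => iteratedFDeriv ℝ n (Function.uncurry Φ) p (fun _ => ((1 : ℝ), (0 : ℝ))) := by
  funext p
  exact iteratedDeriv_slice_left hΦ n p.1 p.2

/-- A slice-derivative field of a smooth `Φ` with `tsupport (uncurry Φ)` in the box `R`: smooth,
continuous, box-supported. [folklore] -/
theorem sliceField_props (hΦ : ContDiff ℝ ∞ (Function.uncurry Φ)) {R : ℝ}
    (hR : ∀ p ∈ tsupport (Function.uncurry Φ), |p.1| ≤ R ∧ |p.2| ≤ R) {Θ : ℝ → ℝ → ℂ} {n : ℕ}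
    {v : ℝ × ℝ} (hΘ : Function.uncurry Θ = fun p => iteratedFDeriv ℝ n (Function.uncurry Φ) p (fun _ => v)) :
    ContDiff ℝ ∞ (Function.uncurry Θ) ∧ Continuous (Function.uncurry Θ) ∧ BoxSupport Θ R ∧
      (∀ p ∈ tsupport (Function.uncurry Θ), |p.1| ≤ R ∧ |p.2| ≤ R) := by
  have hsm : ContDiff ℝ ∞ (Function.uncurry Θ) := by
    rw [hΘ]; exact contDiff_iteratedFDeriv_apply_const hΦ n v
  have hts : ∀ p ∈ tsupport (Function.uncurry Θ), |p.1| ≤ R ∧ |p.2| ≤ R := fun p hp =>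
    hR p (by rw [hΘ] at hp; exact tsupport_iteratedFDeriv_apply_const_subset _ n v hp)
  exact ⟨hsm, hsm.continuous, boxSupport_of_tsupport_subset hts, hts⟩

/-- **Absolute convergence of the dual lattice sum for a smooth compactly supported weight**:
`Σ_{(k₁,k₂) ∈ ℤ²} |Φ̂(k₁/c,k₂/c)| < ∞` (`c > 0`). [folklore] -/
theorem summable_fourier2_lattice_of_contDiff (hΦ : ContDiff ℝ ∞ (Function.uncurry Φ))
    (hΦc : HasCompactSupport (Function.uncurry Φ)) {c : ℝ} (hc0 : 0 < c) :
    Summable fun k : ℤ × ℤ => fourier2 Φ (k.1 / c) (k.2 / c) := by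
  obtain ⟨R, -, hR⟩ := exists_tsupport_subset_box hΦc
  -- Θ₁ = ∂₁²Φ, Θ₂ = ∂₂²Φ, Θ₂₁ = ∂₁²Θ₂
  set Θ₁ : ℝ → ℝ → ℂ := fun t₁ t₂ => iteratedDeriv 2 (fun s => Φ s t₂) t₁ with hΘ₁
  set Θ₂ : ℝ → ℝ → ℂ := fun t₁ t₂ => iteratedDeriv 2 (Φ t₁) t₂ with hΘ₂
  obtain ⟨_, h₁c, h₁s, -⟩ := sliceField_props hΦ hR (uncurry_iteratedDeriv_slice_left hΦ 2)
  obtain ⟨h₂sm, h₂c, h₂s, h₂R⟩ := sliceField_props hΦ hR (uncurry_iteratedDeriv_slice_right hΦ 2)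
  set Θ₂₁ : ℝ → ℝ → ℂ := fun t₁ t₂ => iteratedDeriv 2 (fun s => Θ₂ s t₂) t₁ with hΘ₂₁
  obtain ⟨_, h₃c, h₃s, -⟩ := sliceField_props h₂sm h₂R (uncurry_iteratedDeriv_slice_left h₂sm 2)
  exact summable_fourier2_lattice (boxSupport_of_tsupport_subset hR) hΦ.continuous
    (contDiff_slice_left hΦ) (contDiff_slice_right hΦ) (Θ₁ := Θ₁) (fun _ => rfl) h₁s h₁c
    (Θ₂ := Θ₂) (fun _ => rfl) h₂s h₂c (contDiff_slice_left h₂sm) (Θ₂₁ := Θ₂₁) (fun _ => rfl)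
    h₃s h₃c hc0

variable {c : ℕ} [NeZero c]

/-- **Twisted Poisson summation in two variables, lattice form, for a smooth compactly supported weight,
in d2's Kloosterman shape.** For `uncurry Φ` smooth of compact support, `c ≥ 1`, `K : ZMod c → ZMod c → ℂ`:
`Σ_{(n₁,n₂) ∈ ℤ²} Φ(n₁,n₂) K(n₁,n₂) = c⁻² Σ_{(k₁,k₂) ∈ ℤ²} Φ̂(k₁/c,k₂/c) · Σ_{x₁,x₂ : ZMod c} K(x₁,x₂) e_c(k₁x₁ + k₂x₂)`,
both sides absolutely convergent. [folklore] -/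
theorem tsum_prod_mul_stdAddChar_eq_of_contDiff (hΦ : ContDiff ℝ ∞ (Function.uncurry Φ))
    (hΦc : HasCompactSupport (Function.uncurry Φ)) (K : ZMod c → ZMod c → ℂ) :
    ∑' n : ℤ × ℤ, Φ n.1 n.2 * K (n.1 : ZMod c) (n.2 : ZMod c) =
      ((c : ℂ)⁻¹) ^ 2 * ∑' k : ℤ × ℤ, fourier2 Φ (k.1 / c) (k.2 / c) *
        ∑ x₁ : ZMod c, ∑ x₂ : ZMod c,
          K x₁ x₂ * (ZMod.stdAddChar ((k.1 : ZMod c) * x₁ + (k.2 : ZMod c) * x₂) : ℂ) := by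
  have hc0 : 0 < c := Nat.pos_of_ne_zero (NeZero.ne c)
  have hcr : (0 : ℝ) < c := by exact_mod_cast hc0
  obtain ⟨R, C₁, hR, hbox, hcont, hs₁, hs₂, hC⟩ := poissonHypotheses_of_contDiff hΦ hΦc
  rw [tsum_prod_mul_eq_tsum_tsum hbox (fun u v => K (u : ZMod c) (v : ZMod c)),
    tsum_tsum_mul_stdAddChar_eq hbox hcont hR hs₁ hs₂ hC K]
  congr 1
  -- the dual sum is absolutely convergent: pass to the lattice
  have hB : ∀ k₁ k₂ : ℤ, ‖∑ x₁ : ZMod c, ∑ x₂ : ZMod c,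
      K x₁ x₂ * (ZMod.stdAddChar ((k₁ : ZMod c) * x₁ + (k₂ : ZMod c) * x₂) : ℂ)‖ ≤
        ∑ x₁ : ZMod c, ∑ x₂ : ZMod c, ‖K x₁ x₂‖ := by
    intro k₁ k₂
    refine (norm_sum_le _ _).trans (Finset.sum_le_sum fun x₁ _ => ?_)
    refine (norm_sum_le _ _).trans (le_of_eq (Finset.sum_congr rfl fun x₂ _ => ?_))
    rw [norm_mul, AddChar.norm_apply, mul_one]
  have hWs : Summable fun k : ℤ × ℤ => fourier2 Φ (k.1 / c) (k.2 / c) *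
      ∑ x₁ : ZMod c, ∑ x₂ : ZMod c,
        K x₁ x₂ * (ZMod.stdAddChar ((k.1 : ZMod c) * x₁ + (k.2 : ZMod c) * x₂) : ℂ) := by
    refine Summable.of_norm_bounded ((summable_fourier2_lattice_of_contDiff hΦ hΦc hcr).norm.mul_right
      (∑ x₁ : ZMod c, ∑ x₂ : ZMod c, ‖K x₁ x₂‖)) (fun k => ?_)
    rw [norm_mul]
    exact mul_le_mul_of_nonneg_left (hB k.1 k.2) (norm_nonneg _)
  exact tsum_tsum_eq_tsum_prod_swap hWs

/-- The same with the left side over pairs of natural numbers, for `Φ` living on the open quadrant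
(`Φ(t₁,t₂) ≠ 0 ⇒ t₁, t₂ > 0`) — the shape of the layers of `PeterssonSplit.offDiag`:
`Σ_{(n₁,n₂) ∈ ℕ²} Φ(n₁,n₂) K(n₁,n₂) = c⁻² Σ_{(k₁,k₂) ∈ ℤ²} Φ̂(k₁/c,k₂/c) · Σ_{x₁,x₂ : ZMod c} K(x₁,x₂) e_c(k₁x₁ + k₂x₂)`.
[folklore] -/
theorem tsum_nat_prod_mul_stdAddChar_eq_of_contDiff (hΦ : ContDiff ℝ ∞ (Function.uncurry Φ))
    (hΦc : HasCompactSupport (Function.uncurry Φ)) (hpos : ∀ t₁ t₂, Φ t₁ t₂ ≠ 0 → 0 < t₁ ∧ 0 < t₂)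
    (K : ZMod c → ZMod c → ℂ) :
    ∑' n : ℕ × ℕ, Φ n.1 n.2 * K (n.1 : ZMod c) (n.2 : ZMod c) =
      ((c : ℂ)⁻¹) ^ 2 * ∑' k : ℤ × ℤ, fourier2 Φ (k.1 / c) (k.2 / c) *
        ∑ x₁ : ZMod c, ∑ x₂ : ZMod c,
          K x₁ x₂ * (ZMod.stdAddChar ((k.1 : ZMod c) * x₁ + (k.2 : ZMod c) * x₂) : ℂ) := by
  rw [← tsum_prod_mul_stdAddChar_eq_of_contDiff hΦ hΦc K,
    ← tsum_nat_prod_eq_tsum_int_prod hpos (fun u v => K (u : ZMod c) (v : ZMod c))]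
  exact tsum_congr fun n => by simp

end Smooth

end Summit.Parity.GeneralizedHardyLittlewood.Theorems.BeyondDiagonalBeatsQuarter.OffDiagPoissonTwisted
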